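import Summits.CriticalPhenomena.CardyFormulaZ2.Theses.CardyWickAnisotropy
import Summits.CriticalPhenomena.CardyFormulaZ2.Theorems.CardyWickAnisotropyAnisotropicBoxCardyReduction
import Summits.CriticalPhenomena.CardyFormulaZ2.Theorems.CardyWickAnisotropyAnisotropicBoxCardyStubFirstJetRusso
import Summits.CriticalPhenomena.CardyFormulaZ2.Theorems.CardyWickAnisotropyAnisotropicBoxCardyStubFirstJetTarget
import Summits.CriticalPhenomena.CardyFormulaZ2.Theorems.CardyWickAnisotropyAnisotropicBoxCardyStubWalshJets
import HarnessLib

/-!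
# Crux `CardyWickAnisotropy.AnisotropicBoxCardy` (stmt-CriticalPhenomena-14309), line `birth`:
# the residue of the line is exactly the route item `TaylorIdentification`

Lead c3 (2026-08-17).  After the reshapes c2/c2b the registered skeleton of line `birth` reads
`AnisotropicBoxCardy_of : DiscNormality → FirstTwistedMoment → OddLevelSums → AnisotropicBoxCardy`,
with `DiscNormality` the route item stmt-CriticalPhenomena-10255 by name and the two remaining
percolation stubs

* `FirstTwistedMoment` (`k = 1`): the signed pivotal expectation of the self-dual box at `p = 1/2`,
  `Piv n = E_½[N^piv_h − N^piv_v]([0,n+1]×[0,n])` (a finite signed count), converges to the closed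
  constant `c₁ = 2√3·(cardyConst/3)·(1/4)^(-2/3)·(π/2)·θ₄(i)⁴ = 2√3·(−Π_h′(1)) = 1.80219…`;
* `OddLevelSums` (odd `k ≥ 3`): the rescaled twisted Fourier–Walsh level sums `k!·2^k·W n k` of the
  crossing indicator converge to the Taylor data at `1/2` of every holomorphic continuation `G` of
  the Cardy side.

This file records, as theorems of the tree, that these two stubs are JOINTLY EQUIVALENT to the
route item `TaylorIdentification` (stmt-CriticalPhenomena-14427) — unconditionally, using only the
landed dictionary stubs `stub_firstJetRusso` (Russo: `(V n)′(1/2) = Piv n`), `stub_firstJetTarget`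
(`G′(1/2) = c₁`), `stub_walshJets` (`(V n)^(k)(1/2) = k!·2^k·W n k`), `stub_evenJets` and the
existence/uniqueness of the continuation (`cardySideContinuation`, `cardySideContinuation_unique`):

* `taylorIdentification_iff_twistedMoments : TaylorIdentification ↔ FirstTwistedMoment ∧ OddLevelSums`;
* `anisotropicBoxCardy_of_discNormality_of_twistedMoments` — the registered composition of the line,
  now importable: `DiscNormality → FirstTwistedMoment → OddLevelSums → AnisotropicBoxCardy`;
* `twistedMoments_of_discNormality_of_anisotropicBoxCardy` — tightness at the level of the c2 stubs:
  `DiscNormality → AnisotropicBoxCardy → FirstTwistedMoment ∧ OddLevelSums`.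

So the open residue of the line is, by name, `{DiscNormality (10255), TaylorIdentification (14427)}`
— the two hypotheses of the landed `vitaliStep_proof` — and, modulo `DiscNormality`, the crux, the item
`TaylorIdentification` and the pair of stubs are all equivalent.  Nothing here is new percolation: the
content is bookkeeping that pins the residue for the planner (both stubs are research-grade: `k = 1`
is an exact scaling-limit constant for a signed pivotal count on critical bond-`ℤ²`).
-/

namespace Summit.CriticalPhenomena.CardyFormulaZ2.Theorems

open scoped Classical
open Filter Topology
open Summit.CriticalPhenomena.CardyFormulaZ2.Theses.CardyWickAnisotropy
  (DiscNormality TaylorIdentification RealAxisDictionary VitaliStep AnisotropicBoxCardy)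

/-- **`TaylorIdentification` gives the first twisted moment** (`k = 1` rung, necessity): if the jets of
`V n` at `1/2` converge to those of a holomorphic continuation `G` of the Cardy side, then
`E_½[N^piv_h − N^piv_v](R_n) = (V n)′(1/2) → G′(1/2) = c₁` (`stub_firstJetRusso`, `stub_firstJetTarget`). -/
theorem firstTwistedMoment_of_taylorIdentification (hT : TaylorIdentification) :
  let E : ℕ → Finset (Sym2 (Literature.Probability.LatticeModels.Site 2)) := fun n ↦ ((Literature.Probability.Percolation.rectangle (n + 1) n ×ˢ Literature.Probability.Percolation.rectangle (n + 1) n).filter (fun xy ↦ (Literature.Probability.LatticeModels.zdGraph 2).Adj xy.1 xy.2)).image (fun xy ↦ s(xy.1, xy.2)); let Piv : ℕ → ℝ := fun n ↦ ∑ e ∈ E n, (if (∃ x y : Literature.Probability.LatticeModels.Site 2, e = s(x, y) ∧ x 1 = y 1) then (1:ℝ) else -1) * (2 * ((((E n).erase e).powerset.filter (fun ω ↦ ((↑(insert e ω) : Set (Sym2 (Literature.Probability.LatticeModels.Site 2))) ∈ Literature.Probability.Percolation.lrCrossing (n + 1) n) ∧ ((↑ω : Set (Sym2 (Literature.Probability.LatticeModels.Site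 2))) ∉ Literature.Probability.Percolation.lrCrossing (n + 1) n))).card : ℝ) / (2:ℝ) ^ (E n).card); let c₁ : ℝ := 2 * Real.sqrt 3 * (Literature.Probability.RandomPlanarGeometry.cardyConst / 3) * (1 / 4 : ℝ) ^ (-(2 / 3 : ℝ)) * (Real.pi / 2) * (Literature.NumberTheory.EllipticCurves.JacobiThetaNull.theta4 Complex.I).re ^ 4; Filter.Tendsto (fun n : ℕ ↦ Piv n) Filter.atTop (nhds c₁) := by
  have hR := stub_firstJetRusso
  have hTg := stub_firstJetTarget
  dsimp only [TaylorIdentification] at hT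
  dsimp only at hR hTg ⊢
  obtain ⟨G, hG, hval, hjets⟩ := hT
  have h1 := hjets 1
  simp only [iteratedDeriv_one] at h1
  rw [hTg G hG hval] at h1
  simp_rw [hR] at h1
  have h2 := (Complex.continuous_re.tendsto _).comp h1
  simpa only [Function.comp_def, Complex.ofReal_re] using h2

/-- **`TaylorIdentification` gives the odd twisted level sums** (odd `k ≥ 3`, necessity): the jets of
`V n` at `1/2` are the rescaled level sums (`stub_walshJets`), and any continuation `G` of the Cardy
side agrees on `D` with the one provided by `TaylorIdentification` (`cardySideContinuation_unique`),
hence has the same Taylor data at `1/2`. -/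
theorem oddLevelSums_of_taylorIdentification (hT : TaylorIdentification) :
  let E : ℕ → Finset (Sym2 (Literature.Probability.LatticeModels.Site 2)) := fun n ↦ ((Literature.Probability.Percolation.rectangle (n + 1) n ×ˢ Literature.Probability.Percolation.rectangle (n + 1) n).filter (fun xy ↦ (Literature.Probability.LatticeModels.zdGraph 2).Adj xy.1 xy.2)).image (fun xy ↦ s(xy.1, xy.2)); let W : ℕ → ℕ → ℝ := fun n k ↦ ∑ T ∈ (E n).powersetCard k, (-1 : ℝ) ^ (T.filter (fun e ↦ ¬ ∃ x y : Literature.Probability.LatticeModels.Site 2, e = s(x, y) ∧ x 1 = y 1)).card * ((∑ ω ∈ (E n).powerset, (if ((ω : Set (Sym2 (Literature.Probability.LatticeModels.Site 2))) ∈ Literature.Probability.Percolation.lrCrossing (n + 1) n) then (-1 : ℝ) ^ (T \ ω).card else 0)) / (2 : ℝ) ^ (E n).card); let PiH : ℝ → ℝ := fun r ↦ Literature.Probability.RandomPlanarGeometry.cardyFunction (((Literature.NumberTheory.EllipticCurves.JacobiThetaNull.theta2 (Complex.I * (r : ℂ)) / Literature.NumberTheory.EllipticCurves.JacobiThetaNull.theta3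 (Complex.I * (r : ℂ))) ^ 4).re); ∀ G : ℂ → ℂ, DifferentiableOn ℂ G (Metric.ball ((1:ℂ) / 2) (1 / 2)) → (∀ α ∈ Set.Ioo (0:ℝ) Real.pi, G ((Literature.Probability.LatticeModels.criticalWeight (α / 2) : ℝ) : ℂ) = ((PiH (Real.cos (α / 2) / Real.sin (α / 2)) : ℝ) : ℂ)) → ∀ k : ℕ, Odd k → 3 ≤ k → Filter.Tendsto (fun n : ℕ ↦ ((((k.factorial : ℝ) * 2 ^ k * W n k : ℝ)) : ℂ)) Filter.atTop (nhds (iteratedDeriv k G ((1:ℂ) / 2))) := by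
  have hW := stub_walshJets
  dsimp only [TaylorIdentification] at hT
  dsimp only at hW ⊢
  obtain ⟨G, hG, hval, hjets⟩ := hT
  intro G' hG' hval' k _hk _h3
  have h0 : ((1:ℂ) / 2) ∈ Metric.ball ((1:ℂ) / 2) (1 / 2) := Metric.mem_ball_self (by norm_num)
  have hEq : Set.EqOn G' G (Metric.ball ((1:ℂ) / 2) (1 / 2)) :=
    cardySideContinuation_unique hG' hG (fun α hα ↦ by rw [hval' α hα, hval α hα])
  have hEqk : iteratedDeriv k G' ((1:ℂ) / 2) = iteratedDeriv k G ((1:ℂ) / 2) :=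
    Filter.EventuallyEq.iteratedDeriv_eq k
      (Filter.eventuallyEq_of_mem (Metric.isOpen_ball.mem_nhds h0) hEq)
  rw [hEqk]
  have h1 := hjets k
  simp_rw [hW] at h1
  exact h1

/-- **The two twisted-moment stubs give `TaylorIdentification`** (sufficiency — the registered
composition of line `birth` below the Vitali step): the continuation exists (`cardySideContinuation`),
the even jets converge (`stub_evenJets`), the first jet is the first twisted moment (`stub_firstJetRusso`,
`stub_firstJetTarget`) and the odd jets of order `≥ 3` are the odd level sums (`stub_walshJets`). -/
theorem taylorIdentification_of_twistedMoments
    (hM : let E : ℕ → Finset (Sym2 (Literature.Probability.LatticeModels.Site 2)) := fun n ↦ ((Literature.Probability.Percolation.rectangle (n + 1) n ×ˢ Literature.Probability.Percolation.rectangle (n + 1) n).filter (fun xy ↦ (Literature.Probability.LatticeModels.zdGraph 2).Adj xy.1 xy.2)).image (fun xy ↦ s(xy.1, xy.2)); let Piv : ℕ → ℝ := fun n ↦ ∑ e ∈ E n, (if (∃ x y : Literature.Probability.LatticeModels.Site 2, e = s(x, y) ∧ x 1 = y 1) then (1:ℝ) else -1) * (2 * ((((E n).erase e).powerset.filter (fun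 ω ↦ ((↑(insert e ω) : Set (Sym2 (Literature.Probability.LatticeModels.Site 2))) ∈ Literature.Probability.Percolation.lrCrossing (n + 1) n) ∧ ((↑ω : Set (Sym2 (Literature.Probability.LatticeModels.Site 2))) ∉ Literature.Probability.Percolation.lrCrossing (n + 1) n))).card : ℝ) / (2:ℝ) ^ (E n).card); let c₁ : ℝ := 2 * Real.sqrt 3 * (Literature.Probability.RandomPlanarGeometry.cardyConst / 3) * (1 / 4 : ℝ) ^ (-(2 / 3 : ℝ)) * (Real.pi / 2) * (Literature.NumberTheory.EllipticCurves.JacobiThetaNull.theta4 Complex.I).re ^ 4; Filter.Tendsto (fun n : ℕ ↦ Piv n) Filter.atTop (nhds c₁))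
    (hL : let E : ℕ → Finset (Sym2 (Literature.Probability.LatticeModels.Site 2)) := fun n ↦ ((Literature.Probability.Percolation.rectangle (n + 1) n ×ˢ Literature.Probability.Percolation.rectangle (n + 1) n).filter (fun xy ↦ (Literature.Probability.LatticeModels.zdGraph 2).Adj xy.1 xy.2)).image (fun xy ↦ s(xy.1, xy.2)); let W : ℕ → ℕ → ℝ := fun n k ↦ ∑ T ∈ (E n).powersetCard k, (-1 : ℝ) ^ (T.filter (fun e ↦ ¬ ∃ x y : Literature.Probability.LatticeModels.Site 2, e = s(x, y) ∧ x 1 = y 1)).card * ((∑ ω ∈ (E n).powerset, (if ((ω : Set (Sym2 (Literature.Probability.LatticeModels.Site 2))) ∈ Literature.Probability.Percolation.lrCrossing (n + 1) n) then (-1 : ℝ) ^ (T \ ω).card else 0)) / (2 : ℝ) ^ (E n).card); let PiH : ℝ → ℝ := fun r ↦ Literature.Probability.RandomPlanarGeometry.cardyFunction (((Literature.NumberTheory.EllipticCurves.JacobiThetaNull.theta2 (Complex.I * (r : ℂ)) / Literature.NumberTheory.EllipticCurves.JacobiThetaNull.theta3 (Complex.I * (r : ℂ))) ^ 4).re); ∀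 G : ℂ → ℂ, DifferentiableOn ℂ G (Metric.ball ((1:ℂ) / 2) (1 / 2)) → (∀ α ∈ Set.Ioo (0:ℝ) Real.pi, G ((Literature.Probability.LatticeModels.criticalWeight (α / 2) : ℝ) : ℂ) = ((PiH (Real.cos (α / 2) / Real.sin (α / 2)) : ℝ) : ℂ)) → ∀ k : ℕ, Odd k → 3 ≤ k → Filter.Tendsto (fun n : ℕ ↦ ((((k.factorial : ℝ) * 2 ^ k * W n k : ℝ)) : ℂ)) Filter.atTop (nhds (iteratedDeriv k G ((1:ℂ) / 2)))) :
    TaylorIdentification := by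
  have hR := stub_firstJetRusso
  have hTg := stub_firstJetTarget
  have hW := stub_walshJets
  have hE := stub_evenJets
  have hC := cardySideContinuation
  dsimp only at hM hL hR hTg hW hE hC
  dsimp only [TaylorIdentification]
  obtain ⟨G, hG, hval⟩ := hC
  refine ⟨G, hG, hval, fun k ↦ ?_⟩
  rcases Nat.even_or_odd k with hk | hk
  · exact hE G hG hval k hk
  · by_cases h3 : 3 ≤ k
    · simp_rw [hW]
      exact hL G hG hval k hk h3
    · obtain ⟨j, rfl⟩ := hk
      have hj : j = 0 := by omega
      subst hj
      simp only [Nat.mul_zero, Nat.zero_add, iteratedDeriv_one]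
      simp_rw [hR, hTg G hG hval]
      exact (Complex.continuous_ofReal.tendsto _).comp hM

/-- **The residue of line `birth` is exactly `TaylorIdentification`**: the route item
stmt-CriticalPhenomena-14427 is equivalent to the conjunction of the line's two open percolation stubs
(`FirstTwistedMoment`, `OddLevelSums`), unconditionally. -/
theorem taylorIdentification_iff_twistedMoments :
    TaylorIdentification ↔
      ((let E : ℕ → Finset (Sym2 (Literature.Probability.LatticeModels.Site 2)) := fun n ↦ ((Literature.Probability.Percolation.rectangle (n + 1) n ×ˢ Literature.Probability.Percolation.rectangle (n + 1) n).filter (fun xy ↦ (Literature.Probability.LatticeModels.zdGraph 2).Adj xy.1 xy.2)).image (fun xy ↦ s(xy.1, xy.2)); let Piv : ℕ → ℝ := fun n ↦ ∑ e ∈ E n, (if (∃ x y : Literature.Probability.LatticeModels.Site 2, e = s(x, y) ∧ x 1 = y 1) then (1:ℝ) else -1) * (2 * ((((E n).erase e).powerset.filter (fun ω ↦ ((↑(insert e ω) : Set (Sym2 (Literature.Probability.LatticeModels.Site 2))) ∈ Literature.Probability.Percolation.lrCrossing (n + 1) n) ∧ ((↑ω : Set (Sym2 (Literature.Probability.LatticeModels.Site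 2))) ∉ Literature.Probability.Percolation.lrCrossing (n + 1) n))).card : ℝ) / (2:ℝ) ^ (E n).card); let c₁ : ℝ := 2 * Real.sqrt 3 * (Literature.Probability.RandomPlanarGeometry.cardyConst / 3) * (1 / 4 : ℝ) ^ (-(2 / 3 : ℝ)) * (Real.pi / 2) * (Literature.NumberTheory.EllipticCurves.JacobiThetaNull.theta4 Complex.I).re ^ 4; Filter.Tendsto (fun n : ℕ ↦ Piv n) Filter.atTop (nhds c₁)) ∧
        (let E : ℕ → Finset (Sym2 (Literature.Probability.LatticeModels.Site 2)) := fun n ↦ ((Literature.Probability.Percolation.rectangle (n + 1) n ×ˢ Literature.Probability.Percolation.rectangle (n + 1) n).filter (fun xy ↦ (Literature.Probability.LatticeModels.zdGraph 2).Adj xy.1 xy.2)).image (fun xy ↦ s(xy.1, xy.2)); let W : ℕ → ℕ → ℝ := fun n k ↦ ∑ T ∈ (E n).powersetCard k, (-1 : ℝ) ^ (T.filter (fun e ↦ ¬ ∃ x y : Literature.Probability.LatticeModels.Site 2, e = s(x, y) ∧ x 1 = y 1)).card * ((∑ ω ∈ (E n).powerset, (if ((ω : Set (Sym2 (Literature.Probability.LatticeModels.Site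 2))) ∈ Literature.Probability.Percolation.lrCrossing (n + 1) n) then (-1 : ℝ) ^ (T \ ω).card else 0)) / (2 : ℝ) ^ (E n).card); let PiH : ℝ → ℝ := fun r ↦ Literature.Probability.RandomPlanarGeometry.cardyFunction (((Literature.NumberTheory.EllipticCurves.JacobiThetaNull.theta2 (Complex.I * (r : ℂ)) / Literature.NumberTheory.EllipticCurves.JacobiThetaNull.theta3 (Complex.I * (r : ℂ))) ^ 4).re); ∀ G : ℂ → ℂ, DifferentiableOn ℂ G (Metric.ball ((1:ℂ) / 2) (1 / 2)) → (∀ α ∈ Set.Ioo (0:ℝ) Real.pi, G ((Literature.Probability.LatticeModels.criticalWeight (α / 2) : ℝ) : ℂ) = ((PiH (Real.cos (α / 2) / Real.sin (α / 2)) : ℝ) : ℂ)) → ∀ k : ℕ, Odd k → 3 ≤ k → Filter.Tendsto (fun n : ℕ ↦ ((((k.factorial : ℝ) * 2 ^ k * W n k : ℝ)) : ℂ)) Filter.atTop (nhds (iteratedDeriv k G ((1:ℂ) / 2))))) :=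
  ⟨fun hT ↦ ⟨firstTwistedMoment_of_taylorIdentification hT, oddLevelSums_of_taylorIdentification hT⟩,
    fun h ↦ taylorIdentification_of_twistedMoments h.1 h.2⟩

/-- **The crux from exactly the open residue of line `birth`** (the registered composition, importable):
`DiscNormality` (stmt-CriticalPhenomena-10255), the first twisted moment and the odd level sums give
`AnisotropicBoxCardy` through the landed Vitali step and real-axis dictionary. -/
theorem anisotropicBoxCardy_of_discNormality_of_twistedMoments (hN : DiscNormality)
    (hM : let E : ℕ → Finset (Sym2 (Literature.Probability.LatticeModels.Site 2)) := fun n ↦ ((Literature.Probability.Percolation.rectangle (n + 1) n ×ˢ Literature.Probability.Percolation.rectangle (n + 1) n).filter (fun xy ↦ (Literature.Probability.LatticeModels.zdGraph 2).Adj xy.1 xy.2)).image (fun xy ↦ s(xy.1, xy.2)); let Piv : ℕ → ℝ := fun n ↦ ∑ e ∈ E n, (if (∃ x y : Literature.Probability.LatticeModels.Site 2, e = s(x, y) ∧ x 1 = y 1) then (1:ℝ) else -1) * (2 * ((((E n).erase e).powerset.filter (fun ω ↦ ((↑(insert e ω) : Set (Sym2 (Literature.Probability.LatticeModels.Site 2)))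 ∈ Literature.Probability.Percolation.lrCrossing (n + 1) n) ∧ ((↑ω : Set (Sym2 (Literature.Probability.LatticeModels.Site 2))) ∉ Literature.Probability.Percolation.lrCrossing (n + 1) n))).card : ℝ) / (2:ℝ) ^ (E n).card); let c₁ : ℝ := 2 * Real.sqrt 3 * (Literature.Probability.RandomPlanarGeometry.cardyConst / 3) * (1 / 4 : ℝ) ^ (-(2 / 3 : ℝ)) * (Real.pi / 2) * (Literature.NumberTheory.EllipticCurves.JacobiThetaNull.theta4 Complex.I).re ^ 4; Filter.Tendsto (fun n : ℕ ↦ Piv n) Filter.atTop (nhds c₁))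
    (hL : let E : ℕ → Finset (Sym2 (Literature.Probability.LatticeModels.Site 2)) := fun n ↦ ((Literature.Probability.Percolation.rectangle (n + 1) n ×ˢ Literature.Probability.Percolation.rectangle (n + 1) n).filter (fun xy ↦ (Literature.Probability.LatticeModels.zdGraph 2).Adj xy.1 xy.2)).image (fun xy ↦ s(xy.1, xy.2)); let W : ℕ → ℕ → ℝ := fun n k ↦ ∑ T ∈ (E n).powersetCard k, (-1 : ℝ) ^ (T.filter (fun e ↦ ¬ ∃ x y : Literature.Probability.LatticeModels.Site 2, e = s(x, y) ∧ x 1 = y 1)).card * ((∑ ω ∈ (E n).powerset, (if ((ω : Set (Sym2 (Literature.Probability.LatticeModels.Site 2))) ∈ Literature.Probability.Percolation.lrCrossing (n + 1) n) then (-1 : ℝ) ^ (T \ ω).card else 0)) / (2 : ℝ) ^ (E n).card); let PiH : ℝ → ℝ := fun r ↦ Literature.Probability.RandomPlanarGeometry.cardyFunction (((Literature.NumberTheory.EllipticCurves.JacobiThetaNull.theta2 (Complex.I * (r : ℂ)) / Literature.NumberTheory.EllipticCurves.JacobiThetaNull.theta3 (Complex.I * (r : ℂ))) ^ 4).re); ∀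 G : ℂ → ℂ, DifferentiableOn ℂ G (Metric.ball ((1:ℂ) / 2) (1 / 2)) → (∀ α ∈ Set.Ioo (0:ℝ) Real.pi, G ((Literature.Probability.LatticeModels.criticalWeight (α / 2) : ℝ) : ℂ) = ((PiH (Real.cos (α / 2) / Real.sin (α / 2)) : ℝ) : ℂ)) → ∀ k : ℕ, Odd k → 3 ≤ k → Filter.Tendsto (fun n : ℕ ↦ ((((k.factorial : ℝ) * 2 ^ k * W n k : ℝ)) : ℂ)) Filter.atTop (nhds (iteratedDeriv k G ((1:ℂ) / 2)))) :
    AnisotropicBoxCardy :=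
  vitaliStep_proof hN (taylorIdentification_of_twistedMoments hM hL) realAxisDictionary_proof

/-- **Tightness at the level of the open stubs**: given `DiscNormality`, the crux forces both the first
twisted moment and the odd level sums (Vitali–Porter, `taylorIdentification_of_discNormality_of_anisotropicBoxCardy`,
then necessity).  So modulo `DiscNormality` the crux, `TaylorIdentification` and the pair of stubs are
equivalent; the line reformulates the crux and does not weaken it. -/
theorem twistedMoments_of_discNormality_of_anisotropicBoxCardy (hN : DiscNormality)
    (hA : AnisotropicBoxCardy) :
    (let E : ℕ → Finset (Sym2 (Literature.Probability.LatticeModels.Site 2)) := fun n ↦ ((Literature.Probability.Percolation.rectangle (n + 1) n ×ˢ Literature.Probability.Percolation.rectangle (n + 1) n).filter (fun xy ↦ (Literature.Probability.LatticeModels.zdGraph 2).Adj xy.1 xy.2)).image (fun xy ↦ s(xy.1, xy.2)); let Piv : ℕ → ℝ := fun n ↦ ∑ e ∈ E n, (if (∃ x y : Literature.Probability.LatticeModels.Site 2, e = s(x, y) ∧ x 1 = y 1) then (1:ℝ) else -1) * (2 * ((((E n).erase e).powerset.filter (fun ω ↦ ((↑(insert e ω) : Set (Sym2 (Literature.Probability.LatticeModels.Site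 2))) ∈ Literature.Probability.Percolation.lrCrossing (n + 1) n) ∧ ((↑ω : Set (Sym2 (Literature.Probability.LatticeModels.Site 2))) ∉ Literature.Probability.Percolation.lrCrossing (n + 1) n))).card : ℝ) / (2:ℝ) ^ (E n).card); let c₁ : ℝ := 2 * Real.sqrt 3 * (Literature.Probability.RandomPlanarGeometry.cardyConst / 3) * (1 / 4 : ℝ) ^ (-(2 / 3 : ℝ)) * (Real.pi / 2) * (Literature.NumberTheory.EllipticCurves.JacobiThetaNull.theta4 Complex.I).re ^ 4; Filter.Tendsto (fun n : ℕ ↦ Piv n) Filter.atTop (nhds c₁)) ∧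
      (let E : ℕ → Finset (Sym2 (Literature.Probability.LatticeModels.Site 2)) := fun n ↦ ((Literature.Probability.Percolation.rectangle (n + 1) n ×ˢ Literature.Probability.Percolation.rectangle (n + 1) n).filter (fun xy ↦ (Literature.Probability.LatticeModels.zdGraph 2).Adj xy.1 xy.2)).image (fun xy ↦ s(xy.1, xy.2)); let W : ℕ → ℕ → ℝ := fun n k ↦ ∑ T ∈ (E n).powersetCard k, (-1 : ℝ) ^ (T.filter (fun e ↦ ¬ ∃ x y : Literature.Probability.LatticeModels.Site 2, e = s(x, y) ∧ x 1 = y 1)).card * ((∑ ω ∈ (E n).powerset, (if ((ω : Set (Sym2 (Literature.Probability.LatticeModels.Site 2))) ∈ Literature.Probability.Percolation.lrCrossing (n + 1) n) then (-1 : ℝ) ^ (T \ ω).card else 0)) / (2 : ℝ) ^ (E n).card); let PiH : ℝ → ℝ := fun r ↦ Literature.Probability.RandomPlanarGeometry.cardyFunction (((Literature.NumberTheory.EllipticCurves.JacobiThetaNull.theta2 (Complex.I * (r : ℂ)) / Literature.NumberTheory.EllipticCurves.JacobiThetaNull.theta3 (Complex.I * (r : ℂ))) ^ 4).re); ∀ G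 : ℂ → ℂ, DifferentiableOn ℂ G (Metric.ball ((1:ℂ) / 2) (1 / 2)) → (∀ α ∈ Set.Ioo (0:ℝ) Real.pi, G ((Literature.Probability.LatticeModels.criticalWeight (α / 2) : ℝ) : ℂ) = ((PiH (Real.cos (α / 2) / Real.sin (α / 2)) : ℝ) : ℂ)) → ∀ k : ℕ, Odd k → 3 ≤ k → Filter.Tendsto (fun n : ℕ ↦ ((((k.factorial : ℝ) * 2 ^ k * W n k : ℝ)) : ℂ)) Filter.atTop (nhds (iteratedDeriv k G ((1:ℂ) / 2)))) :=
  taylorIdentification_iff_twistedMoments.mp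
    (taylorIdentification_of_discNormality_of_anisotropicBoxCardy hN hA)

end Summit.CriticalPhenomena.CardyFormulaZ2.Theorems
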